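import Literature.Probability.Percolation.PercolationProofs
import Summits.CriticalPhenomena.PercolationContinuityZ3.Theorems.PercNearOneGluingNoHeavyLowerTailKnQuestion8CoefficientwiseHarris
import HarnessLib

/-!
# The smallest open atom of the coefficientwise programme is a theorem: `E[1{C_x(ω) ∩ A = ∅}·Δf·Δg] ≥ 0`

Support file (`--supports stmt-CriticalPhenomena-4575`, closed), prover `prim-lf-2` (gen 23).  No definitions, no named facts, no sorries;
standard axioms.  Memo `prim-lf-2/CW-TLEMMA-gen23.md`; programme page `prim-lf-2/CW-PROGRAMME-gen21.md`.

Setting.  A finite multigraph with edge set `ι` and end-point map `ends : ι → Sym2 V`; a colouring is `s : Finset ι` (the red edges; `sᶜ` the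
blue ones); `C_x(s) = openCluster (ends '' s) x` is the red vertex cluster of `x` and `C_x(sᶜ)` the blue one; `f, g : Set V → ℝ` monotone,
`Δf(s) = f(C_x(s)) − f(C_x(sᶜ))`.  prim-lf-2 gen 21 reduced the count-one joint Bernstein coefficient of van den Berg–Häggström–Kahn's
conditional positive association ("coefficientwise vdBHK-PA", conjecture CW-PA) for a pendant conditioning vertex `z ∼ v` to
  `T(v) := Σ_{s : v ∉ C_x(s)} Δf(s)·Δg(s) ≥ 0`
(conjecture (C3), 'the smallest open atom': one graph, one vertex, two increasing functions of the uniform colouring; exact census 1.4·10⁶ / 0).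

* `Coefficientwise.offCluster_twoColouring_nonneg` — THEOREM: for every vertex set `A`,
  `0 ≤ Σ_{s : A ∩ C_x(s) = ∅} (f(C_x s) − f(C_x sᶜ))·(g(C_x s) − g(C_x sᶜ))`;  `A = {v}` is (C3), `A = ∅` is `harris_twoColouring`.
Proof.  Freeze the red cluster `S` of the SET `A` together with the red edges inside it: the event `{A ∩ C_x(s) = ∅} = {x ∉ S}` is a disjoint union
of cells `{t | t ∩ I(S) = π}` (`I(S)` = edges at `S`, `π ⊆` edges inside `S`), and on such a cell `C_x(t) = C_x(t \ I(S)) ⊆ C_x((I(S) \ π) ∪ (t \ I(S)))`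
(a red path from `x ∉ S` never meets `S`; the blue cluster of `x` has the whole boundary of `S` at its disposal), which is the pointwise hypothesis of
`Coefficientwise.twoColouring_cell_nonneg_of_le` (FKG on the cell: both factors are monotone with non-positive cell means).
* `Coefficientwise.reachable_transfer` — the walk-transfer tool (a `G₁`-walk from inside a set `S` whose `G₁`-edges at `S` are `G₂`-edges into `S`
  is a `G₂`-walk ending in `S`).
[cite: KozmaNitzan2024, Questions 8–9 (§5.5 p. 36) (context: the Question-8 pocket covariance programme)]
-/

namespace Summit.CriticalPhenomena.PercolationContinuityZ3.Theorems

open Finset Literature.Probability.Percolation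

namespace Coefficientwise

/-- Walk transfer: if every `G₁`-edge at a vertex of `S` is a `G₂`-edge whose other end lies in `S`, then a `G₁`-walk starting in `S` yields
`G₂`-reachability and ends in `S`.  (Elementary; used three times below.) [cite: KozmaNitzan2024, §5.5 (context only)] -/
theorem reachable_transfer {V : Type*} {G₁ G₂ : SimpleGraph V} (S : Set V)
    (h : ∀ u ∈ S, ∀ w, G₁.Adj u w → G₂.Adj u w ∧ w ∈ S) {u v : V} (p : G₁.Walk u v) :
    u ∈ S → G₂.Reachable u v ∧ v ∈ S := by
  induction p with
  | nil => exact fun hu => ⟨SimpleGraph.Reachable.refl _, hu⟩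
  | cons hadj p ih =>
    intro hu
    obtain ⟨h2, hw⟩ := h _ hu _ hadj
    obtain ⟨hr, hv⟩ := ih hw
    exact ⟨h2.reachable.trans hr, hv⟩

variable {ι V : Type*}

/-- Adjacency in the red graph of a colouring `s`: `u ∼ w` iff some red edge has ends `{u, w}` and `u ≠ w`.
[cite: KozmaNitzan2024, §5.5 (context only)] -/
theorem openGraph_image_adj (ends : ι → Sym2 V) (s : Finset ι) (u w : V) :
    (openGraph (ends '' (↑s : Set ι))).Adj u w ↔ (∃ i ∈ s, ends i = s(u, w)) ∧ u ≠ w := by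
  rw [openGraph_adj, Set.mem_image]
  simp only [Finset.mem_coe]

/-- The red cluster of a configuration grows with the configuration. [cite: KozmaNitzan2024, §5.5 (context only)] -/
theorem openCluster_image_mono (ends : ι → Sym2 V) {s t : Finset ι} (hst : s ⊆ t) (x : V) :
    openCluster (ends '' (↑s : Set ι)) x ⊆ openCluster (ends '' (↑t : Set ι)) x :=
  openCluster_mono (Set.image_mono (Finset.coe_subset.mpr hst)) x

variable [Fintype ι] [DecidableEq ι]

open Classical in
/-- **The smallest open atom of prim-lf-2's coefficientwise programme (conjecture (C3)) — proved, with an avoided SET.**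
For a finite multigraph (`ends : ι → Sym2 V`), a vertex `x`, a vertex set `A` and monotone `f, g : Set V → ℝ`,
  `0 ≤ Σ_{s ⊆ ι : A ∩ C_x(s) = ∅} (f(C_x(s)) − f(C_x(sᶜ)))·(g(C_x(s)) − g(C_x(sᶜ)))`,
where `C_x(s) = openCluster (ends '' s) x` is the cluster of `x` in the red edges `s` and `sᶜ` are the blue edges; i.e. for the uniform
two-colouring, `E[1{C_x(red) ∩ A = ∅}·Δf·Δg] ≥ 0`.  `A = {v}`: `T(v) ≥ 0`, hence coefficientwise vdBHK-PA for pendant conditioning vertices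
(CW-PROGRAMME (P4)); `A = ∅`: `harris_twoColouring`.  Proof: cells of the red cluster of `A` + `twoColouring_cell_nonneg_of_le`.
[cite: KozmaNitzan2024, Questions 8–9 (§5.5 p. 36) (context)] -/
theorem offCluster_twoColouring_nonneg (ends : ι → Sym2 V) (x : V) (A : Set V) (f g : Set V → ℝ)
    (hf : Monotone f) (hg : Monotone g) :
    0 ≤ ∑ s ∈ univ.filter (fun s : Finset ι => ∀ a ∈ A, a ∉ openCluster (ends '' (↑s : Set ι)) x),
      (f (openCluster (ends '' (↑s : Set ι)) x) - f (openCluster (ends '' (↑(sᶜ) : Set ι)) x)) *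
        (g (openCluster (ends '' (↑s : Set ι)) x) - g (openCluster (ends '' (↑(sᶜ) : Set ι)) x)) := by
  -- notation
  set K : Finset ι → Set V := fun s => openCluster (ends '' (↑s : Set ι)) x with hK
  set F : Finset ι → ℝ := fun s => f (K s) with hF
  set G : Finset ι → ℝ := fun s => g (K s) with hG
  set D : Finset (Finset ι) := univ.filter (fun s : Finset ι => ∀ a ∈ A, a ∉ openCluster (ends '' (↑s : Set ι)) x) with hD
  change 0 ≤ ∑ s ∈ D, (F s - F sᶜ) * (G s - G sᶜ)
  have hKmono : ∀ {s t : Finset ι}, s ⊆ t → K s ⊆ K t := fun hst => openCluster_image_mono ends hst x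
  have hFm : Monotone F := fun s t hst => hf (hKmono hst)
  have hGm : Monotone G := fun s t hst => hg (hKmono hst)
  -- the red cluster of the set `A`, the edges at a vertex set, and the cell key
  set R : Finset ι → Set V := fun s => {y | ∃ a ∈ A, y ∈ openCluster (ends '' (↑s : Set ι)) a} with hR
  set I : Set V → Finset ι := fun S => univ.filter (fun i : ι => ∃ v ∈ S, v ∈ ends i) with hI
  set key : Finset ι → Set V × Finset ι := fun s => (R s, s ∩ I (R s)) with hkey
  -- basic facts about `R`
  have R_closed : ∀ (s : Finset ι) {u w : V}, u ∈ R s → (openGraph (ends '' (↑s : Set ι))).Adj u w → w ∈ R s := by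
    intro s u w hu hadj
    obtain ⟨a, haA, hau⟩ := hu
    exact ⟨a, haA, SimpleGraph.Reachable.trans hau hadj.reachable⟩
  have mem_I : ∀ (S : Set V) (i : ι) (v : V), v ∈ S → v ∈ ends i → i ∈ I S := by
    intro S i v hv hvi
    simp only [hI, Finset.mem_filter, Finset.mem_univ, true_and]
    exact ⟨v, hv, hvi⟩
  have A_sub_R : ∀ (s : Finset ι), ∀ a ∈ A, a ∈ R s := fun s a ha => ⟨a, ha, mem_openCluster_self _ a⟩
  -- (L3) locality: a configuration agreeing with `s₀` on the edges at `R s₀` has the same red cluster of `A`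
  have locality : ∀ s₀ t : Finset ι, t ∩ I (R s₀) = s₀ ∩ I (R s₀) → R t = R s₀ := by
    intro s₀ t ht
    have agree : ∀ i, i ∈ I (R s₀) → (i ∈ t ↔ i ∈ s₀) := by
      intro i hi
      have := congrArg (fun u : Finset ι => i ∈ u) ht
      simp only [Finset.mem_inter, hi, and_true, eq_iff_iff] at this
      exact this
    -- transfer s₀-walks to t-walks inside `R s₀`
    have h1 : ∀ u ∈ R s₀, ∀ w, (openGraph (ends '' (↑s₀ : Set ι))).Adj u w →
        (openGraph (ends '' (↑t : Set ι))).Adj u w ∧ w ∈ R s₀ := by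
      intro u hu w hadj
      refine ⟨?_, R_closed s₀ hu hadj⟩
      rw [openGraph_image_adj] at hadj ⊢
      obtain ⟨⟨i, his, hi⟩, hne⟩ := hadj
      have hiI : i ∈ I (R s₀) := mem_I _ i u hu (by rw [hi]; exact Sym2.mem_mk_left u w)
      exact ⟨⟨i, (agree i hiI).mpr his, hi⟩, hne⟩
    -- transfer t-walks to s₀-walks inside `R s₀`
    have h2 : ∀ u ∈ R s₀, ∀ w, (openGraph (ends '' (↑t : Set ι))).Adj u w →
        (openGraph (ends '' (↑s₀ : Set ι))).Adj u w ∧ w ∈ R s₀ := by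
      intro u hu w hadj
      have hadj' : (openGraph (ends '' (↑s₀ : Set ι))).Adj u w := by
        rw [openGraph_image_adj] at hadj ⊢
        obtain ⟨⟨i, hit, hi⟩, hne⟩ := hadj
        have hiI : i ∈ I (R s₀) := mem_I _ i u hu (by rw [hi]; exact Sym2.mem_mk_left u w)
        exact ⟨⟨i, (agree i hiI).mp hit, hi⟩, hne⟩
      exact ⟨hadj', R_closed s₀ hu hadj'⟩
    ext y
    constructor
    · rintro ⟨a, haA, hay⟩
      obtain ⟨p⟩ := hay
      exact ((reachable_transfer (R s₀) h2 p) (A_sub_R s₀ a haA)).2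
    · rintro ⟨a, haA, hay⟩
      obtain ⟨p⟩ := hay
      exact ⟨a, haA, ((reachable_transfer (R s₀) h1 p) (A_sub_R s₀ a haA)).1⟩
  -- split the sum over `D` along the fibres of `key`
  rw [← Finset.sum_fiberwise_of_maps_to (s := D) (t := D.image key) (g := key)
    (fun s hs => Finset.mem_image_of_mem key hs)]
  refine Finset.sum_nonneg fun k hk => ?_
  obtain ⟨s₀, hs₀D, rfl⟩ := Finset.mem_image.mp hk
  have hs₀ : ∀ a ∈ A, a ∉ K s₀ := by
    have := (Finset.mem_filter.mp hs₀D).2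
    simpa [hK] using this
  -- abbreviations for the frozen data of the cell of `s₀`
  set S₀ : Set V := R s₀ with hS₀
  set B : Finset ι := I S₀ with hB
  set π : Finset ι := s₀ ∩ B with hπ
  have hxS₀ : x ∉ S₀ := by
    rintro ⟨a, haA, hax⟩
    exact hs₀ a haA (SimpleGraph.Reachable.symm hax)
  -- (L4) the fibre of `key s₀` in `D` is exactly the cell `{t | t ∩ B = π}`
  have fiber_eq : D.filter (fun t => key t = key s₀) = univ.filter (fun t : Finset ι => t ∩ B = π) := by
    ext t
    simp only [Finset.mem_filter, Finset.mem_univ, true_and]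
    constructor
    · rintro ⟨_, hkt⟩
      have h1 : R t = S₀ := (Prod.ext_iff.mp hkt).1
      have h2 : t ∩ I (R t) = s₀ ∩ I (R s₀) := (Prod.ext_iff.mp hkt).2
      rw [h1] at h2
      exact h2
    · intro ht
      have hRt : R t = S₀ := locality s₀ t ht
      refine ⟨?_, ?_⟩
      · rw [hD, Finset.mem_filter]
        refine ⟨Finset.mem_univ _, fun a haA hax => ?_⟩
        have hxRt : x ∈ R t := ⟨a, haA, SimpleGraph.Reachable.symm hax⟩
        rw [hRt] at hxRt
        exact hxS₀ hxRt
      · change (R t, t ∩ I (R t)) = (R s₀, s₀ ∩ I (R s₀))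
        rw [hRt]
        exact Prod.ext rfl ht
  rw [fiber_eq]
  -- (L5) on the cell, the red cluster of `x` uses no edge at `S₀`
  have offcluster : ∀ t : Finset ι, t ∩ B = π → K t ⊆ K ((B \ π) ∪ (t \ B)) := by
    intro t ht
    have agree : ∀ i, i ∈ B → (i ∈ t ↔ i ∈ s₀) := by
      intro i hi
      have := congrArg (fun u : Finset ι => i ∈ u) ht
      simp only [hπ, Finset.mem_inter, hi, and_true, eq_iff_iff] at this
      exact this
    have htr : ∀ u ∈ S₀ᶜ, ∀ w, (openGraph (ends '' (↑t : Set ι))).Adj u w →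
        (openGraph (ends '' (↑(t \ B) : Set ι))).Adj u w ∧ w ∈ S₀ᶜ := by
      intro u hu w hadj
      rw [openGraph_image_adj] at hadj
      obtain ⟨⟨i, hit, hi⟩, hne⟩ := hadj
      -- the edge `i` is not at `S₀`
      have hiB : i ∉ B := by
        intro hiB
        have his₀ : i ∈ s₀ := (agree i hiB).mp hit
        have hiB' := hiB
        simp only [hB, hI, Finset.mem_filter, Finset.mem_univ, true_and] at hiB'
        obtain ⟨v, hvS, hvi⟩ := hiB'
        rw [hi, Sym2.mem_iff] at hvi
        rcases hvi with rfl | rfl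
        · exact hu hvS
        · -- `w ∈ S₀` and the red edge `i ∈ s₀` joins `w` to `u`, so `u ∈ S₀`
          have hadj₀ : (openGraph (ends '' (↑s₀ : Set ι))).Adj v u := by
            rw [openGraph_image_adj]
            exact ⟨⟨i, his₀, by rw [hi, Sym2.eq_swap]⟩, hne.symm⟩
          exact hu (R_closed s₀ hvS hadj₀)
      have hwS : w ∈ S₀ᶜ := by
        intro hwS
        exact hiB (mem_I S₀ i w hwS (by rw [hi]; exact Sym2.mem_mk_right u w))
      refine ⟨?_, hwS⟩
      rw [openGraph_image_adj]
      exact ⟨⟨i, Finset.mem_sdiff.mpr ⟨hit, hiB⟩, hi⟩, hne⟩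
    intro y hy
    obtain ⟨p⟩ := hy
    have hreach := ((reachable_transfer S₀ᶜ htr p) hxS₀).1
    exact hKmono Finset.subset_union_right hreach
  refine twoColouring_cell_nonneg_of_le B π Finset.inter_subset_right F G hFm hGm ?_ ?_
  · intro t ht; exact hf (offcluster t ht)
  · intro t ht; exact hg (offcluster t ht)

end Coefficientwise

end Summit.CriticalPhenomena.PercolationContinuityZ3.Theorems
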